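import Literature.Analysis.Toeplitz.BernsteinSzegoCompressedShift
import HarnessLib

/-!
# The `ℓ²(ℤ)` shift model of a Bernstein–Szegő system

Topic `Analysis/Toeplitz`, namespace `Literature.Analysis.Toeplitz`, objects in the sub-namespace
`BernsteinSzego.ShiftModel`. Companion to `BernsteinSzegoCompressedShift.lean`, which proves the
finite-section consequences (Newton basis, `Tr(Q_n U^l Q_n) = ∑ r_i^l`, power identity) of the
abstract hypothesis structure `BernsteinSzego.IsBernsteinSzego`. Here that hypothesis is
DISCHARGED in the canonical model.

**Source.** G. Szegő, *Orthogonal Polynomials* [Szego1939], §11.2 Theorem 11.2, eq. (11.2.2):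
for `f(θ) = 1/|h(e^{iθ})|²` (`h` a polynomial of degree `m`, `h(0) ≠ 0`, no zeros in `|z| ≤ 1`)
the orthonormal polynomials are `φ_n(z) = z^{n-m} h^*(z)`, `n ≥ m`; Szegő's proof is the Cauchy
integral `(2πi)^{-1}∫_{|z|=1} z^{n-1}\overline{ρ}(z^{-1})/h(z) dz = 0` for `ρ ∈ π_{n-1}`.

**Model.** Under the unitary `L²(𝕋, f dθ/2π) → L²(𝕋, dθ/2π) → ℓ²(ℤ)`, `g ↦ g/h ↦` Fourier
coefficients, multiplication by `z` becomes the bilateral shift `S` (`ShiftModel.shift`), the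
constant function `1` becomes the one-sided sequence `e = (b_t)_{t≥0}` of Taylor coefficients of
`1/h = ∑_t b_t z^t` (`ShiftModel.baseVec`), `z^m ↦ S^m e`, and the Gram matrix `⟪S^a e, S^m e⟫` is
the Toeplitz matrix of the autocorrelation `A(k) = ∑_t \bar b_t b_{t+k} = \hat f(k)`
(`ShiftModel.inner_shift_pow_baseVec`). In these coordinates Szegő's Cauchy-integral step is the
algebraic identity `∑_{i≤σ} h_i A(k-i) = \overline{b̃_{-k}}` (`ShiftModel.sum_mul_corr`), a
rearrangement of the convolution identity `∑_i h_i b_{n-i} = δ_{n,0}` (`h · (1/h) = 1`).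

**Main results (all proved, no named facts).**
* `ShiftModel.inner_shift_pow_psiVec_eq_zero` — `⟪S^j ψ', S^m e⟫ = 0` for `m < j + σ`, where
  `ψ' = h^*(S) e` (`ShiftModel.psiVec`): Szegő's orthogonality (11.2.2) in the model;
* `ShiftModel.linearIndependent_shift_pow_baseVec` — the translates `S^m e` are independent;
* **`ShiftModel.isBernsteinSzego`** — hence `IsBernsteinSzego S e r` for any enumeration `r` of the
  zeros of `h^*` (hypothesis `hroots : \overline{h_0} ∏ (X - r_i) = h^*`), and therefore
  (`ShiftModel.trace_compShift`, `ShiftModel.compShift_one_pow`, `ShiftModel.trace_compShift_zero`)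
  the exact finite-section trace formula `Tr(Q_n S^l Q_n) = ∑_i r_i^l` (`l ≥ 1`, `σ ≤ n + 1`),
  `Tr Q_n = n + 1`, and `(Q_n S Q_n)^l = Q_n S^l Q_n`.

**The function-field weights (section `FunctionField`, all hypotheses discharged).** For a finite
family of degrees `d_v ≥ 1` (`v ∈ S`) and a real `c` with `|c| < 1`, put
`p_S = ∏_{v∈S} (1 - c^{d_v} X^{d_v})` (`FunctionField.pS`; for `c = q^{-1/2}` this is Connes'
`∏_v (1 - (z/√q)^{d_v})`, `1/|p_S(e^{iθ})|² = |ζ_S(½+it)|²` on `k = 𝔽_q(T)` [Connes1999, §VIII]),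
`b = ` Taylor coefficients of `1/p_S` (`FunctionField.bS`, via the formal inverses
`∑_k c^{kd}X^{kd}` of the local factors; `FunctionField.conv_pS`), which are absolutely and square
summable (`FunctionField.summable_norm_bS`, Cauchy products of geometric series), and
`p_S^* = ∏_v (X^{d_v} - c^{d_v})` (`FunctionField.reflect_pS`) with the enumerated roots
`ζ_{d_v}^j c` (`FunctionField.rootEnum`, `FunctionField.hroots_pS`). CONCLUSION
(`FunctionField.trace_compShift`, `.trace_compShift_zero`, `.compShift_one_pow`): for every level
`n` with `∑_v d_v ≤ n + 1` and every `l ≥ 1`,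
`Tr(Q_n S^l Q_n) = c^l ∑_{v∈S, d_v ∣ l} d_v`, `Tr Q_n = n + 1`, `(Q_n S Q_n)^l = Q_n S^l Q_n` —
with `c = q^{-1/2}` these are the values `q^{-|l|/2}∑_{d_v∣l} d_v` and `2N+3` of Connes' semilocal
trace formula in positive characteristic [Connes1999, §VIII Lemma 1 eq. (12), Cor. 2], obtained here
EXACTLY at every finite level above the threshold `deg S ≤ dim` (no `o(1)`), for the Toeplitz
system of `|ζ_S(½+it)|²`. What is NOT formalised is the identification of that Toeplitz system with
Connes' cutoff space `B_Λ ⊂ L²(X_S)` (a computation on [Connes1999] VIII (5)–(14)).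

**Coefficient field.** In the general model (section `ShiftModel`) the scalars are any `RCLike 𝕜`
and the coefficients `hc : ℕ → 𝕜` of `h` and the roots `r` are ARBITRARY (complex phases allowed),
so twisted weights `∏_v (1 - κ_v z^{d_v})` with complex `κ_v` (character sectors) are covered by
`ShiftModel.isBernsteinSzego` / `ShiftModel.trace_compShift` as soon as their `b` is supplied; only
the fully discharged section `FunctionField` specialises to real `c` (`κ_v = c^{d_v}`). Paper
counterpart in the hub's construction census: `THRESHOLD-LAW-THEOREM.md` (reader t2-r4) §2(a),(c)
[`χ = 1` on `𝔽_q(T)`], §8.4(a),(c), §9 R2–R3; the model identification Connes VIII (5)–(14) ↦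
Toeplitz(`|L_S(χ̄,½+it)|²`) is Lemma 1 / Lemma 8.3 / 9.2 there (not formalised).

**Hypotheses kept explicit in the general model (honest scope).** The data are coefficient sequences: `hc : ℕ → 𝕜`
(coefficients of `h`, vanishing above `σ`: `hdeg`), `b : ℕ → 𝕜` with the convolution identity
`hconv : ∑_{i≤n} h_i b_{n-i} = δ_{n,0}` (i.e. `b` = Taylor coefficients of `1/h`, which forces
`h_0 ≠ 0`), and the single analytic input `hb : ∑_t ‖b_t‖² < ∞` — equivalent to "`h` has no zeros in
the closed unit disc" (radius of convergence of `1/h` exceeds `1`), which is NOT derived here. For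
the number-theoretic instance that motivated the file (Connes, Selecta Math. 5 (1999) §VIII
[Connes1999]: `h = p_S(z) = ∏_{v∈S}(1 - (z/√q)^{d_v})`, `q > 1`, so `b_t = r_S(t) q^{-t/2} ≥ 0` with
`∑_t b_t = ∏_v (1 - q^{-d_v/2})^{-1} < ∞`) the hypothesis holds; that verification and the adelic
dictionary are not part of this file.

## References

* [Szego1939] G. Szegő, *Orthogonal Polynomials*, AMS Colloq. Publ. 23, §11.2 Thm 11.2 (11.2.2).
* [Connes1999] A. Connes, Selecta Math. (N.S.) 5 (1999) 29–106, §VIII Lemma 1, Cor. 2.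
-/

noncomputable section

open scoped InnerProductSpace
open Submodule Module Polynomial

namespace Literature.Analysis.Toeplitz

namespace BernsteinSzego

variable {𝕜 : Type*} [RCLike 𝕜]

/-! ## The `ℓ²(ℤ)` shift model: Bernstein–Szegő orthogonality from `h · (1/h) = 1`

Under the unitary `L²(𝕋, f dθ/2π) → ℓ²(ℤ)`, `g ↦` Fourier coefficients of `g/h` (`f = 1/|h|²`), the
operator `M_z` becomes the bilateral shift, the constant `1` becomes the (one-sided) coefficient
sequence `b` of `1/h(z) = ∑_{t≥0} b_t z^t`, and `z^m` becomes its translates. In this model Szegő's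
orthogonality `z^j h^* ⊥_f 𝒫_{j+m-1}` is the purely algebraic identity `∑_i h_i b_{n-i} = δ_{n,0}`
summed against `b̄`, which is what is checked below (`ShiftModel.isBernsteinSzego`). The analytic
input is reduced to the single hypothesis `∑ ‖b_t‖² < ∞` (true iff `h` has no zeros in the closed
unit disc; not derived here). -/

namespace ShiftModel

/-- Translation of a two-sided sequence: `(translate c x) t = x (t + c)`. [folklore] -/
def translate (c : ℤ) (x : ℤ → 𝕜) : ℤ → 𝕜 := fun t => x (t + c)

/-- Translation preserves square-summability. [folklore] -/
private theorem memℓp_translate (c : ℤ) {x : ℤ → 𝕜} (hx : Memℓp x 2) : Memℓp (translate c x) 2 := by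
  have h2 : 0 < (2 : ENNReal).toReal := by norm_num
  rw [memℓp_gen_iff h2] at hx ⊢
  exact (Equiv.addRight c).summable_iff.mpr hx

/-- Translation by `c` as a linear map on `ℓ²(ℤ)`; `translateL (-1)` is the bilateral (forward)
shift `(S x) t = x (t - 1)`. [folklore] -/
def translateL (c : ℤ) : lp (fun _ : ℤ => 𝕜) 2 →ₗ[𝕜] lp (fun _ : ℤ => 𝕜) 2 where
  toFun x := ⟨translate c x, memℓp_translate c (lp.memℓp x)⟩
  map_add' x y := by ext t; rfl
  map_smul' a x := by ext t; rfl

/-- The bilateral shift `S` on `ℓ²(ℤ)`: `(S x) t = x (t - 1)` (the model of `M_z`). [folklore] -/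
def shift : lp (fun _ : ℤ => 𝕜) 2 →ₗ[𝕜] lp (fun _ : ℤ => 𝕜) 2 := translateL (-1)

/-- Coordinates of `S^l x`: `(S^l x) t = x (t - l)`. [folklore] -/
private theorem shift_pow_apply (x : lp (fun _ : ℤ => 𝕜) 2) (l : ℕ) (t : ℤ) :
    ((shift ^ l) x : ℤ → 𝕜) t = x (t - l) := by
  induction l generalizing t with
  | zero => simp
  | succ l ih =>
    rw [pow_succ', Module.End.mul_apply]
    change ((shift ^ l) x : ℤ → 𝕜) (t + (-1)) = _
    rw [ih, show t + (-1) - (l : ℤ) = t - ((l + 1 : ℕ) : ℤ) by push_cast; ring]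

/-- The zero extension of a one-sided sequence to `ℤ`. [folklore] -/
def extZ (b : ℕ → 𝕜) (t : ℤ) : 𝕜 := if 0 ≤ t then b t.toNat else 0

/-- `extZ b n = b n` on `ℕ`. [folklore] -/
@[simp] private theorem extZ_natCast (b : ℕ → 𝕜) (n : ℕ) : extZ b n = b n := by
  simp [extZ]

/-- `extZ b t = 0` for `t < 0`. [folklore] -/
private theorem extZ_of_neg (b : ℕ → 𝕜) {t : ℤ} (ht : t < 0) : extZ b t = 0 := by
  simp [extZ, not_le.mpr ht]

/-- A square-summable one-sided sequence gives an element of `ℓ²(ℤ)`. [folklore] -/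
private theorem memℓp_extZ {b : ℕ → 𝕜} (hb : Summable fun t => ‖b t‖ ^ 2) :
    Memℓp (extZ b : ℤ → 𝕜) 2 := by
  have h2 : 0 < (2 : ENNReal).toReal := by norm_num
  rw [memℓp_gen_iff h2]
  refine Summable.of_nat_of_neg_add_one ?_ ?_
  · simpa using hb
  · have : ∀ n : ℕ, ‖extZ b (-(n + 1 : ℤ))‖ ^ (2 : ENNReal).toReal = 0 := fun n => by
      rw [extZ_of_neg b (by omega)]
      simp
    simp only [this]
    exact summable_zero

/-- The model vector `e = (b_t)_{t ≥ 0}` (zero for `t < 0`) in `ℓ²(ℤ)`: the Fourier coefficients of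
`1/h`. [folklore] -/
def baseVec (b : ℕ → 𝕜) (hb : Summable fun t => ‖b t‖ ^ 2) : lp (fun _ : ℤ => 𝕜) 2 :=
  ⟨extZ b, memℓp_extZ hb⟩

/-- Underlying function of `baseVec`. [folklore] -/
@[simp] private theorem coe_baseVec (b : ℕ → 𝕜) (hb : Summable fun t => ‖b t‖ ^ 2) :
    (baseVec b hb : ℤ → 𝕜) = extZ b := rfl

/-- The autocorrelation `A(k) = ∑_t \overline{b̃_t} b̃_{t+k}` of the zero-extended sequence — the
Fourier coefficients of the weight `f = |1/h|²` (the Toeplitz/Gram data). [folklore] -/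
def corr (b : ℕ → 𝕜) (k : ℤ) : 𝕜 := ∑' t : ℤ, starRingEnd 𝕜 (extZ b t) * extZ b (t + k)

section model

variable {b : ℕ → 𝕜} (hb : Summable fun t => ‖b t‖ ^ 2)

include hb in
/-- Summability of `t ↦ \bar{b̃}_t b̃_{t+k}` (product of two `ℓ²` sequences). [folklore] -/
private theorem summable_conj_mul_translate (k : ℤ) :
    Summable fun t : ℤ => starRingEnd 𝕜 (extZ b t) * extZ b (t + k) := by
  have := lp.summable_inner (𝕜 := 𝕜) (baseVec b hb) (translateL k (baseVec b hb))
  refine this.congr fun t => ?_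
  rw [RCLike.inner_apply']
  rfl

/-- Gram data of the translates: `⟪S^a e, S^m e⟫ = A(a - m)`. (The Gram matrix of the translates is the Toeplitz matrix `(c_{ν-μ})` of the Fourier constants of the weight.) [cite: Szego1939, §11.1 eqs. (11.1.2)–(11.1.4)] -/
theorem inner_shift_pow_baseVec (a m : ℕ) :
    ⟪(shift ^ a) (baseVec b hb), (shift ^ m) (baseVec b hb)⟫_𝕜 = corr b ((a : ℤ) - m) := by
  rw [lp.inner_eq_tsum]
  simp_rw [RCLike.inner_apply', shift_pow_apply, coe_baseVec]
  rw [corr, ← (Equiv.addRight (a : ℤ)).tsum_eq]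
  refine tsum_congr fun t => ?_
  simp only [Equiv.coe_addRight, add_sub_cancel_right, add_sub_assoc]

variable {σ : ℕ} {hc : ℕ → 𝕜}
  (hdeg : ∀ i, σ < i → hc i = 0)
  (hconv : ∀ n : ℕ, ∑ i ∈ Finset.range (n + 1), hc i * b (n - i) = if n = 0 then 1 else 0)

include hdeg hconv in
/-- The convolution identity `∑_{i ≤ σ} h_i b̃_{n-i} = δ_{n,0}` on all of `ℤ`. [folklore] -/
private theorem conv_int (n : ℤ) :
    ∑ i ∈ Finset.range (σ + 1), hc i * extZ b (n - i) = if n = 0 then 1 else 0 := by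
  by_cases hn : n < 0
  · rw [if_neg hn.ne]
    exact Finset.sum_eq_zero fun i _ => by rw [extZ_of_neg b (by omega), mul_zero]
  · obtain ⟨N, rfl⟩ := Int.eq_ofNat_of_zero_le (not_lt.mp hn)
    have key : ∀ K, σ ≤ K → N ≤ K →
        ∑ i ∈ Finset.range (K + 1), hc i * extZ b ((N : ℤ) - i) =
          ∑ i ∈ Finset.range (σ + 1), hc i * extZ b ((N : ℤ) - i) := by
      intro K hσK _
      refine (Finset.sum_subset (Finset.range_subset_range.mpr (by omega)) ?_).symm
      intro i hi hi'
      rw [hdeg i (by simp at hi hi'; omega), zero_mul]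
    have key2 : ∀ K, σ ≤ K → N ≤ K →
        ∑ i ∈ Finset.range (K + 1), hc i * extZ b ((N : ℤ) - i) =
          ∑ i ∈ Finset.range (N + 1), hc i * b (N - i) := by
      intro K _ hNK
      have hsub : Finset.range (N + 1) ⊆ Finset.range (K + 1) :=
        Finset.range_subset_range.mpr (by omega)
      refine (Finset.sum_subset hsub ?_).symm.trans ?_
      · intro i hi hi'
        rw [extZ_of_neg b (by simp at hi hi'; omega), mul_zero]
      · refine Finset.sum_congr rfl fun i hi => ?_
        have hi' : i ≤ N := by simpa [Nat.lt_succ_iff] using hi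
        rw [show ((N : ℤ) - i) = ((N - i : ℕ) : ℤ) by push_cast [hi']; ring, extZ_natCast]
    rw [← key (max σ N) (le_max_left _ _) (le_max_right _ _),
      key2 (max σ N) (le_max_left _ _) (le_max_right _ _), hconv N]
    simp

include hb hdeg hconv in
/-- **Key identity.** `∑_{i ≤ σ} h_i A(k - i) = \overline{b̃_{-k}}`; in particular it vanishes for
`k ≥ 1`. (Szegő's Cauchy-theorem step `(2πi)^{-1}∫ z^{n-1} \bar ρ(z^{-1})/h(z) dz = 0` in
coefficient form.) [cite: Szego1939, §11.2 Thm 11.2, eq. (11.2.2)] -/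
theorem sum_mul_corr (k : ℤ) :
    ∑ i ∈ Finset.range (σ + 1), hc i * corr b (k - i) = starRingEnd 𝕜 (extZ b (-k)) := by
  have hs : ∀ i ∈ Finset.range (σ + 1),
      Summable fun t : ℤ => hc i * (starRingEnd 𝕜 (extZ b t) * extZ b (t + (k - i))) :=
    fun i _ => (summable_conj_mul_translate hb (k - i)).mul_left (hc i)
  simp_rw [corr, ← tsum_mul_left]
  rw [← Summable.tsum_finsetSum hs]
  have hpt : ∀ t : ℤ, ∑ i ∈ Finset.range (σ + 1), hc i * (starRingEnd 𝕜 (extZ b t) * extZ b (t + (k - i)))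
      = starRingEnd 𝕜 (extZ b t) * if t + k = 0 then 1 else 0 := by
    intro t
    rw [← conv_int hdeg hconv (t + k), Finset.mul_sum]
    refine Finset.sum_congr rfl fun i _ => ?_
    rw [show t + (k - i) = t + k - i by ring]
    ring
  simp_rw [hpt]
  rw [tsum_eq_single (-k)]
  · simp
  · intro t ht
    rw [if_neg (by omega), mul_zero]

/-- The reflected-conjugate combination `ψ' = ∑_{i ≤ σ} \overline{h_{σ-i}} S^i e`
(the coefficient sequence of `h^*(z)/h(z)`). [cite: Szego1939, §11.2 Thm 11.2, eq. (11.2.2)] -/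
def psiVec (hc : ℕ → 𝕜) (σ : ℕ) (hb : Summable fun t => ‖b t‖ ^ 2) : lp (fun _ : ℤ => 𝕜) 2 :=
  ∑ i ∈ Finset.range (σ + 1), starRingEnd 𝕜 (hc (σ - i)) • (shift ^ i) (baseVec b hb)

include hdeg hconv in
/-- **Szegő's orthogonality in the shift model**: `⟪S^j ψ', S^m e⟫ = 0` whenever `m < j + σ`.
[cite: Szego1939, §11.2 Thm 11.2, eq. (11.2.2)] -/
theorem inner_shift_pow_psiVec_eq_zero {j m : ℕ} (hm : m < j + σ) :
    ⟪(shift ^ j) (psiVec hc σ hb), (shift ^ m) (baseVec b hb)⟫_𝕜 = 0 := by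
  have h1 : ⟪(shift ^ j) (psiVec hc σ hb), (shift ^ m) (baseVec b hb)⟫_𝕜 =
      ∑ i ∈ Finset.range (σ + 1), hc (σ - i) * corr b ((j : ℤ) + i - m) := by
    rw [psiVec, map_sum, sum_inner]
    refine Finset.sum_congr rfl fun i _ => ?_
    rw [map_smul, inner_smul_left, RCLike.conj_conj, ← Module.End.mul_apply, ← pow_add,
      inner_shift_pow_baseVec hb]
    push_cast
    ring_nf
  rw [h1, ← Finset.sum_range_reflect]
  have h2 : ∀ i ∈ Finset.range (σ + 1),
      hc (σ - (σ + 1 - 1 - i)) * corr b ((j : ℤ) + ((σ + 1 - 1 - i : ℕ) : ℤ) - m) =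
        hc i * corr b (((j : ℤ) + σ - m) - i) := by
    intro i hi
    have hi' : i ≤ σ := by simpa [Nat.lt_succ_iff] using hi
    rw [show σ + 1 - 1 - i = σ - i by omega, Nat.sub_sub_self hi']
    congr 1
    push_cast [hi']
    ring
  rw [Finset.sum_congr rfl h2, sum_mul_corr hb hdeg hconv, extZ_of_neg b (by omega), map_zero]

include hconv in
/-- `b_0 ≠ 0` (from `h_0 b_0 = 1`). [folklore] -/
private theorem b_zero_ne_zero : b 0 ≠ 0 := by
  have h := hconv 0
  simp only [zero_add, Finset.range_one, Finset.sum_singleton, Nat.sub_zero, if_true] at h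
  intro hb0
  rw [hb0, mul_zero] at h
  exact zero_ne_one h

include hconv in
/-- The translates `S^m e`, `m ∈ ℕ`, are linearly independent (lower-triangular supports with
`b_0 ≠ 0` on the diagonal; in the model: the monomials `z^m`). (Positivity of the Toeplitz forms `H_n`, i.e. independence of the monomials in `L²(f)`.) [cite: Szego1939, §11.1 eqs. (11.1.2)–(11.1.4)] -/
theorem linearIndependent_shift_pow_baseVec :
    LinearIndependent 𝕜 fun m : ℕ => (shift ^ m) (baseVec b hb) := by
  rw [linearIndependent_iff']
  intro s g hg
  have hcoord : ∀ t : ℤ, ∑ m ∈ s, g m * extZ b (t - m) = 0 := by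
    intro t
    have := congrArg (fun x : lp (fun _ : ℤ => 𝕜) 2 => (x : ℤ → 𝕜) t) hg
    simp only [lp.coeFn_sum, lp.coeFn_smul, Finset.sum_apply, Pi.smul_apply, shift_pow_apply,
      coe_baseVec, smul_eq_mul, lp.coeFn_zero, Pi.zero_apply] at this
    exact this
  suffices H : ∀ n : ℕ, n ∈ s → g n = 0 from fun i hi => H i hi
  intro n
  induction n using Nat.strong_induction_on with
  | _ n ih =>
    intro hn
    have h := hcoord n
    rw [Finset.sum_eq_single_of_mem n hn] at h
    · rw [sub_self, show (0 : ℤ) = ((0 : ℕ) : ℤ) from rfl, extZ_natCast] at h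
      exact (mul_eq_zero.mp h).resolve_right (b_zero_ne_zero hconv)
    · intro m hm hmn
      rcases lt_or_gt_of_ne hmn with hlt | hgt
      · rw [ih m hlt hm, zero_mul]
      · rw [extZ_of_neg b (by omega), mul_zero]

variable {r : Fin σ → 𝕜}
  (hroots : C (starRingEnd 𝕜 (hc 0)) * ∏ i : Fin σ, (X - C (r i)) =
    ∑ i ∈ Finset.range (σ + 1), C (starRingEnd 𝕜 (hc (σ - i))) * X ^ i)

include hconv in
/-- `h_0 ≠ 0` (from `h_0 b_0 = 1`). [folklore] -/
private theorem hc_zero_ne_zero : hc 0 ≠ 0 := by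
  have h := hconv 0
  simp only [zero_add, Finset.range_one, Finset.sum_singleton, Nat.sub_zero, if_true] at h
  intro h0
  rw [h0, zero_mul] at h
  exact zero_ne_one h

include hroots in
/-- With `r` an enumeration of the zeros of the reversed polynomial
`h^*(X) = ∑_i \overline{h_{σ-i}} X^i = \overline{h_0} ∏_i (X - r_i)`:
`\overline{h_0} · ψ = ψ'` where `ψ = ∏_i (S - r_i) e` is the abstract Bernstein–Szegő vector.
[cite: Szego1939, §11.2 Thm 11.2, eq. (11.2.2)] -/
theorem smul_newtonVec_eq_psiVec :
    starRingEnd 𝕜 (hc 0) • newtonVec shift (baseVec b hb) r σ = psiVec hc σ hb := by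
  rw [newtonVec_eq_aeval, ← Fin.prod_univ_eq_prod_range (fun i => X - C (rootSeq r i)) σ]
  have hr : (fun i : Fin σ => X - C (rootSeq r (i : ℕ))) = fun i => X - C (r i) := by
    funext i
    rw [rootSeq, dif_pos i.2]
  have hC : ∀ (a : 𝕜) (P : 𝕜[X]) (x : lp (fun _ : ℤ => 𝕜) 2),
      aeval shift (C a * P) x = a • aeval shift P x := fun a P x => by
    rw [map_mul, aeval_C, Module.End.mul_apply, Module.algebraMap_end_apply]
  rw [hr, ← hC, hroots, map_sum, LinearMap.sum_apply, psiVec]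
  refine Finset.sum_congr rfl fun i _ => ?_
  rw [hC, map_pow, aeval_X]

include hdeg hconv hroots in
/-- **The shift model is a Bernstein–Szegő system.** For `h(z) = ∑_{i≤σ} h_i z^i` and
`b` the Taylor coefficients of `1/h` (`∑_i h_i b_{n-i} = δ_{n,0}`) with `∑‖b_t‖² < ∞`, and `r` the
zeros of `h^*`: the bilateral shift on `ℓ²(ℤ)`, the vector `e = (b_t)_{t≥0}` and `r` satisfy
`IsBernsteinSzego` — Szegő's Theorem 11.2 in Fourier coordinates.
[cite: Szego1939, §11.2 Thm 11.2, eq. (11.2.2)] -/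
theorem isBernsteinSzego : IsBernsteinSzego shift (baseVec b hb) r where
  linearIndependent := linearIndependent_shift_pow_baseVec hb hconv
  orthogonal j m hm := by
    have h0 : starRingEnd 𝕜 (starRingEnd 𝕜 (hc 0)) ≠ 0 := by
      rw [RCLike.conj_conj]
      exact hc_zero_ne_zero hconv
    have h := inner_shift_pow_psiVec_eq_zero hb hdeg hconv hm
    rw [← smul_newtonVec_eq_psiVec hb hroots, map_smul, inner_smul_left] at h
    exact (mul_eq_zero.mp h).resolve_left h0

include hdeg hconv hroots in
/-- **Exact finite-section trace formula in the shift model**: for `σ ≤ n + 1` and `l ≥ 1`,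
`Tr(Q_n S^l Q_n) = ∑_i r_i^l` on `H_n = span{e, Se, …, Sⁿe}` (`= 𝒫_n` in `L²(𝕋, dθ/2π|h|²)`),
independently of `n`; `Tr Q_n = n + 1`; and `(Q_n S Q_n)^l = Q_n S^l Q_n`.
[cite: Szego1939, §11.2 Thm 11.2, eq. (11.2.2)] [cite: Connes1999, §VIII Lemma 1 (eq. (12)) and Cor. 2] -/
theorem trace_compShift {n : ℕ} (hσ : σ ≤ n + 1) {l : ℕ} (hl : 1 ≤ l) :
    LinearMap.trace 𝕜 _ (compShift shift (baseVec b hb) n l) = ∑ i : Fin σ, r i ^ l :=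
  (isBernsteinSzego hb hdeg hconv hroots).trace_compShift hσ hl

include hdeg hconv hroots in
/-- The power identity in the shift model. [cite: Szego1939, Thm 11.4.2, eq. (11.4.7)] -/
theorem compShift_one_pow {n : ℕ} (hσ : σ ≤ n + 1) (l : ℕ) :
    compShift shift (baseVec b hb) n 1 ^ l = compShift shift (baseVec b hb) n l :=
  (isBernsteinSzego hb hdeg hconv hroots).compShift_one_pow hσ l

include hdeg hconv hroots in
/-- `Tr Q_n = n + 1` in the shift model. [cite: Connes1999, §VIII Lemma 1 (eq. (12))] -/
theorem trace_compShift_zero (n : ℕ) :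
    LinearMap.trace 𝕜 _ (compShift shift (baseVec b hb) n 0) = (n + 1 : ℕ) :=
  (isBernsteinSzego hb hdeg hconv hroots).trace_compShift_zero n

end model

end ShiftModel

/-! ## The function-field instance: `h = p_S(z) = ∏_{v∈S} (1 - (z/√q)^{d_v})`

For Connes' semilocal system on `𝔽_q(T)` [Connes1999, §VIII] the Bernstein–Szegő polynomial is
`p_S(z) = ∏_{v ∈ S}(1 - c^{d_v} z^{d_v})` with `c = q^{-1/2} ∈ (0,1)`; the Taylor coefficients of
`1/p_S` are `b_t = r_S(t) c^t ≥ 0` (`r_S(t)` = number of effective divisors of degree `t` supported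
on `S`), absolutely summable, and `p_S^*(z) = ∏_v (z^{d_v} - c^{d_v})` has the roots `ζ_{d_v}^j c`.
Below all hypotheses of the shift model are DISCHARGED for this family, so that the finite-section
trace formula holds unconditionally with the values `c^l ∑_{v : d_v ∣ l} d_v`
(`= q^{-l/2} ∑_{d_v ∣ l} d_v`, Connes' `Tr(Q_Λ V(g_l))`). -/

namespace FunctionField

open ShiftModel

variable {ι : Type*}

/-- The local factor `1 - c^d X^d` (written `1 + C(-c^d) X^d`). [cite: Connes1999, §VIII Lemma 1] -/
def localPoly (dv : ℕ) (c : ℝ) : ℂ[X] := 1 + C (-((c : ℂ) ^ dv)) * X ^ dv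

/-- `p_S = ∏_{v ∈ S} (1 - c^{d_v} X^{d_v})` (for `c = q^{-1/2}`: `p_S(z) = ∏_v (1 - (z/√q)^{d_v})`,
`1/|p_S(e^{iθ})|² = |ζ_S(½ + it)|²`). [cite: Connes1999, §VIII Lemma 1] -/
def pS (S : Finset ι) (d : ι → ℕ) (c : ℝ) : ℂ[X] := ∏ v ∈ S, localPoly (d v) c

/-- Coefficients of the inverse local factor `(1 - c^d X^d)^{-1} = ∑_k c^{kd} X^{kd}`. [folklore] -/
def localInvCoeff (dv : ℕ) (c : ℝ) (t : ℕ) : ℂ := if dv ∣ t then (c : ℂ) ^ t else 0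

/-- The inverse local factor as a formal power series. [folklore] -/
def localInv (dv : ℕ) (c : ℝ) : PowerSeries ℂ := PowerSeries.mk (localInvCoeff dv c)

/-- `1/p_S` as a formal power series (product of the inverse local factors). [folklore] -/
def invS (S : Finset ι) (d : ι → ℕ) (c : ℝ) : PowerSeries ℂ := ∏ v ∈ S, localInv (d v) c

/-- The Taylor coefficients `b_t` of `1/p_S` (`= r_S(t) c^t`). [cite: Connes1999, §VIII Lemma 1] -/
def bS (S : Finset ι) (d : ι → ℕ) (c : ℝ) (t : ℕ) : ℂ := PowerSeries.coeff t (invS S d c)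

/-- `(1 - c^d X^d) · ∑_k c^{kd}X^{kd} = 1`. [folklore] -/
private theorem coe_localPoly_mul_localInv {dv : ℕ} (hd : 0 < dv) (c : ℝ) :
    ((localPoly dv c : ℂ[X]) : PowerSeries ℂ) * localInv dv c = 1 := by
  ext n
  have hcoe : ((localPoly dv c : ℂ[X]) : PowerSeries ℂ) =
      1 + PowerSeries.C (-((c : ℂ) ^ dv)) * PowerSeries.X ^ dv := by
    simp [localPoly]
  rw [hcoe, add_mul, one_mul, map_add, mul_assoc, PowerSeries.coeff_C_mul,
    PowerSeries.coeff_X_pow_mul', PowerSeries.coeff_one, localInv, PowerSeries.coeff_mk]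
  by_cases hn : dv ≤ n
  · rw [if_pos hn, PowerSeries.coeff_mk, if_neg (by omega : n ≠ 0)]
    unfold localInvCoeff
    by_cases hdn : dv ∣ n
    · have hdn' : dv ∣ n - dv := Nat.dvd_sub hdn (dvd_refl dv)
      rw [if_pos hdn, if_pos hdn', neg_mul, ← pow_add, Nat.add_sub_cancel' hn, add_neg_cancel]
    · have hdn' : ¬ dv ∣ n - dv := fun h => hdn (by
        have := dvd_add h (dvd_refl dv); rwa [Nat.sub_add_cancel hn] at this)
      rw [if_neg hdn, if_neg hdn', mul_zero, add_zero]
  · rw [if_neg hn, mul_zero, add_zero]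
    unfold localInvCoeff
    by_cases h0 : n = 0
    · subst h0
      simp
    · rw [if_neg h0, if_neg]
      exact fun h => hn (Nat.le_of_dvd (Nat.pos_of_ne_zero h0) h)

/-- `p_S · (1/p_S) = 1` as formal power series. [cite: Connes1999, §VIII Lemma 1 (eqs. (8)–(12))] -/
theorem coe_pS_mul_invS (S : Finset ι) (d : ι → ℕ) (hd : ∀ v ∈ S, 0 < d v) (c : ℝ) :
    ((pS S d c : ℂ[X]) : PowerSeries ℂ) * invS S d c = 1 := by
  rw [pS, invS, ← Polynomial.coeToPowerSeries.ringHom_apply, map_prod, ← Finset.prod_mul_distrib]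
  refine Finset.prod_eq_one fun v hv => ?_
  rw [Polynomial.coeToPowerSeries.ringHom_apply]
  exact coe_localPoly_mul_localInv (hd v hv) c

/-- The convolution identity `∑_{i ≤ n} (p_S)_i b_{n-i} = δ_{n,0}`. [cite: Connes1999, §VIII Lemma 1 (eqs. (8)–(12))] -/
theorem conv_pS (S : Finset ι) (d : ι → ℕ) (hd : ∀ v ∈ S, 0 < d v) (c : ℝ) (n : ℕ) :
    ∑ i ∈ Finset.range (n + 1), (pS S d c).coeff i * bS S d c (n - i) =
      if n = 0 then 1 else 0 := by
  have h := congrArg (PowerSeries.coeff n) (coe_pS_mul_invS S d hd c)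
  rw [PowerSeries.coeff_mul, PowerSeries.coeff_one,
    Finset.Nat.sum_antidiagonal_eq_sum_range_succ (fun i j =>
      PowerSeries.coeff i ((pS S d c : ℂ[X]) : PowerSeries ℂ) * PowerSeries.coeff j (invS S d c))] at h
  simpa [Polynomial.coeff_coe, bS] using h

/-- `deg (1 - c^d X^d) ≤ d`. [folklore] -/
private theorem natDegree_localPoly_le (dv : ℕ) (c : ℝ) : (localPoly dv c).natDegree ≤ dv := by
  unfold localPoly
  refine (Polynomial.natDegree_add_le _ _).trans (max_le (by simp) ?_)
  exact Polynomial.natDegree_C_mul_X_pow_le _ _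

/-- `deg p_S ≤ σ = ∑_{v∈S} d_v`. [folklore] -/
private theorem natDegree_pS_le (S : Finset ι) (d : ι → ℕ) (c : ℝ) :
    (pS S d c).natDegree ≤ ∑ v ∈ S, d v :=
  (Polynomial.natDegree_prod_le _ _).trans (Finset.sum_le_sum fun _ _ => natDegree_localPoly_le _ _)

/-- Coefficients of `p_S` above `σ` vanish. [folklore] -/
private theorem coeff_pS_eq_zero (S : Finset ι) (d : ι → ℕ) (c : ℝ) {i : ℕ} (hi : ∑ v ∈ S, d v < i) :
    (pS S d c).coeff i = 0 :=
  Polynomial.coeff_eq_zero_of_natDegree_lt ((natDegree_pS_le S d c).trans_lt hi)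

/-- `p_S` has real coefficients: `\overline{(p_S)_i} = (p_S)_i`. [folklore] -/
private theorem conj_coeff_pS (S : Finset ι) (d : ι → ℕ) (c : ℝ) (i : ℕ) :
    starRingEnd ℂ ((pS S d c).coeff i) = (pS S d c).coeff i := by
  have hmap : (pS S d c).map (starRingEnd ℂ) = pS S d c := by
    rw [pS, Polynomial.map_prod]
    refine Finset.prod_congr rfl fun v _ => ?_
    simp [localPoly, Complex.conj_ofReal]
  have := congrArg (fun p => Polynomial.coeff p i) hmap
  simpa [Polynomial.coeff_map] using this

/-- `(p_S)_0 = 1`. [folklore] -/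
private theorem coeff_pS_zero (S : Finset ι) (d : ι → ℕ) (hd : ∀ v ∈ S, 0 < d v) (c : ℝ) :
    (pS S d c).coeff 0 = 1 := by
  rw [Polynomial.coeff_zero_eq_eval_zero, pS, Polynomial.eval_prod]
  refine Finset.prod_eq_one fun v hv => ?_
  simp [localPoly, zero_pow (hd v hv).ne']

/-! ### Summability of the Taylor coefficients of `1/p_S` -/

/-- `∑_t ‖b_t‖ < ∞` for `|c| < 1` (`b_t = r_S(t) c^t`). [cite: Connes1999, §VIII Lemma 1 (eqs. (8)–(12))] -/
theorem summable_norm_bS (S : Finset ι) (d : ι → ℕ) {c : ℝ} (hc : |c| < 1) :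
    Summable fun t => ‖bS S d c t‖ := by
  classical
  induction S using Finset.induction_on with
  | empty =>
    refine summable_of_ne_finset_zero (s := {0}) fun t ht => ?_
    rw [Finset.mem_singleton] at ht
    simp [bS, invS, PowerSeries.coeff_one, ht]
  | insert a S ha ih =>
    have hg : Summable fun t => ‖localInvCoeff (d a) c t‖ := by
      refine Summable.of_nonneg_of_le (fun _ => norm_nonneg _) (fun t => ?_)
        (summable_geometric_of_lt_one (abs_nonneg c) hc)
      unfold localInvCoeff
      split_ifs
      · simp [norm_pow, Complex.norm_real, Real.norm_eq_abs]
      · rw [norm_zero]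
        exact pow_nonneg (abs_nonneg c) t
    have hmul := summable_norm_sum_mul_antidiagonal_of_summable_norm hg ih
    refine hmul.congr fun t => ?_
    rw [bS, invS, Finset.prod_insert ha, ← invS, PowerSeries.coeff_mul]
    simp only [localInv, PowerSeries.coeff_mk, bS]

/-- `∑_t ‖b_t‖² < ∞` for `|c| < 1`. [cite: Connes1999, §VIII Lemma 1 (eqs. (8)–(12))] -/
theorem summable_norm_sq_bS (S : Finset ι) (d : ι → ℕ) {c : ℝ} (hc : |c| < 1) :
    Summable fun t => ‖bS S d c t‖ ^ 2 := by
  have h1 := summable_norm_bS S d hc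
  refine Summable.of_norm_bounded_eventually_nat h1 ?_
  have hlt : ∀ᶠ t in Filter.atTop, ‖bS S d c t‖ < 1 :=
    (tendsto_order.1 h1.tendsto_atTop_zero).2 1 one_pos
  filter_upwards [hlt] with t ht
  rw [Real.norm_of_nonneg (sq_nonneg _), sq]
  exact mul_le_of_le_one_left (norm_nonneg _) ht.le

/-! ### The reversed polynomial `p_S^*` and its roots -/

/-- `p_S^*(X) := X^σ p_S(1/X) = ∏_{v∈S} (X^{d_v} - c^{d_v})`: the reflection identity.
[cite: Szego1939, §11.2 Thm 11.2, eq. (11.2.2)] -/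
theorem reflect_pS (S : Finset ι) (d : ι → ℕ) (c : ℝ) :
    Polynomial.reflect (∑ v ∈ S, d v) (pS S d c) = ∏ v ∈ S, (X ^ d v - C ((c : ℂ) ^ d v)) := by
  classical
  induction S using Finset.induction_on with
  | empty => simp [pS]
  | insert a S ha ih =>
    rw [Finset.sum_insert ha, Finset.prod_insert ha, pS, Finset.prod_insert ha, ← pS,
      Polynomial.reflect_mul _ _ (natDegree_localPoly_le (d a) c) (natDegree_pS_le S d c), ih]
    congr 1
    rw [localPoly, Polynomial.reflect_add, Polynomial.reflect_one, Polynomial.reflect_C_mul_X_pow,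
      Polynomial.revAt_le le_rfl, Nat.sub_self, pow_zero, mul_one, map_neg, sub_eq_add_neg]

/-- The reflection as an explicit sum of monomials: `reflect σ p = ∑_{i≤σ} C(p_{σ-i}) X^i` when
`deg p ≤ σ`. [folklore] -/
private theorem reflect_eq_sum_range {p : ℂ[X]} {σ : ℕ} (hp : p.natDegree ≤ σ) :
    Polynomial.reflect σ p = ∑ i ∈ Finset.range (σ + 1), C (p.coeff (σ - i)) * X ^ i := by
  ext k
  rw [Polynomial.coeff_reflect, Polynomial.finsetSum_coeff]
  simp only [Polynomial.coeff_C_mul_X_pow]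
  by_cases hk : k ≤ σ
  · rw [Polynomial.revAt_le hk, Finset.sum_eq_single k]
    · rw [if_pos rfl]
    · intro i _ hik
      rw [if_neg (Ne.symm hik)]
    · intro hk'
      exact absurd (Finset.mem_range.mpr (Nat.lt_succ_of_le hk)) hk'
  · have hk' : σ < k := not_le.mp hk
    rw [Finset.sum_eq_zero fun i hi => ?_]
    · rw [Polynomial.revAt_eq_self_of_lt hk']
      exact Polynomial.coeff_eq_zero_of_natDegree_lt (hp.trans_lt hk')
    · rw [if_neg]
      have := Finset.mem_range.mp hi
      omega

open Complex in
/-- The roots of `p_S^*`: `ζ_{d_v}^j c` for `v ∈ S`, `j < d_v`, as a function on the index finset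
`S.sigma (v ↦ range d_v)`. [cite: Connes1999, §VIII Lemma 1] -/
def rootFun (d : ι → ℕ) (c : ℝ) (p : Σ _ : ι, ℕ) : ℂ :=
  exp (2 * Real.pi * I / (d p.1)) ^ p.2 * (c : ℂ)

/-- The index finset of the roots. [folklore] -/
def rootIndex (S : Finset ι) (d : ι → ℕ) : Finset (Σ _ : ι, ℕ) := S.sigma fun v => Finset.range (d v)

/-- The root index set has `σ = ∑_v d_v` elements. [folklore] -/
private theorem card_rootIndex (S : Finset ι) (d : ι → ℕ) : (rootIndex S d).card = ∑ v ∈ S, d v := by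
  rw [rootIndex, Finset.card_sigma]
  simp

/-- An enumeration `r : Fin σ → ℂ` of the roots `ζ_{d_v}^j c` (`σ = ∑_{v∈S} d_v`). [folklore] -/
def rootEnum (S : Finset ι) (d : ι → ℕ) (c : ℝ) (i : Fin (∑ v ∈ S, d v)) : ℂ :=
  rootFun d c ((rootIndex S d).equivFin.symm (Fin.cast (card_rootIndex S d).symm i))

/-- Reindexing products over the enumeration. [folklore] -/
private theorem prod_rootEnum (S : Finset ι) (d : ι → ℕ) (c : ℝ) {M : Type*} [CommMonoid M] (g : ℂ → M) :
    ∏ i : Fin (∑ v ∈ S, d v), g (rootEnum S d c i) =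
      ∏ v ∈ S, ∏ j ∈ Finset.range (d v), g (rootFun d c ⟨v, j⟩) := by
  rw [Finset.prod_sigma' S (fun v => Finset.range (d v)) (fun v j => g (rootFun d c ⟨v, j⟩))]
  change _ = ∏ x ∈ rootIndex S d, g (rootFun d c x)
  rw [← Finset.prod_coe_sort (rootIndex S d)]
  conv_rhs => rw [← Equiv.prod_comp (rootIndex S d).equivFin.symm,
    ← Equiv.prod_comp (finCongr (card_rootIndex S d).symm)]
  rfl

open Complex in
/-- `\overline{(p_S)_0} ∏_i (X - r_i) = p_S^*` (the `hroots` hypothesis of the shift model).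
[cite: Szego1939, §11.2 Thm 11.2, eq. (11.2.2)] -/
theorem hroots_pS (S : Finset ι) (d : ι → ℕ) (hd : ∀ v ∈ S, 0 < d v) (c : ℝ) :
    C (starRingEnd ℂ ((pS S d c).coeff 0)) * ∏ i : Fin (∑ v ∈ S, d v), (X - C (rootEnum S d c i)) =
      ∑ i ∈ Finset.range ((∑ v ∈ S, d v) + 1),
        C (starRingEnd ℂ ((pS S d c).coeff ((∑ v ∈ S, d v) - i))) * X ^ i := by
  simp_rw [conj_coeff_pS]
  rw [coeff_pS_zero S d hd, map_one, one_mul, ← reflect_eq_sum_range (natDegree_pS_le S d c),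
    reflect_pS, prod_rootEnum S d c (fun z => X - C z)]
  refine Finset.prod_congr rfl fun v hv => ?_
  rw [X_pow_sub_C_pow_eq_prod (hd v hv)]
  rfl

open Complex in
/-- Power sums of the enumerated roots: `∑_i r_i^l = c^l ∑_{v ∈ S, d_v ∣ l} d_v`.
[cite: Connes1999, §VIII Lemma 1 (eq. (12)) and Cor. 2] -/
theorem sum_rootEnum_pow (S : Finset ι) (d : ι → ℕ) (hd : ∀ v ∈ S, 0 < d v) (c : ℝ) (l : ℕ) :
    ∑ i : Fin (∑ v ∈ S, d v), rootEnum S d c i ^ l = (c : ℂ) ^ l * ∑ v ∈ S with d v ∣ l, (d v : ℂ) := by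
  have := prod_rootEnum S d c (M := Multiplicative ℂ) (fun z => Multiplicative.ofAdd (z ^ l))
  have h2 : ∑ i : Fin (∑ v ∈ S, d v), rootEnum S d c i ^ l =
      ∑ v ∈ S, ∑ j ∈ Finset.range (d v), (rootFun d c ⟨v, j⟩) ^ l := by
    simpa using congrArg Multiplicative.toAdd this
  rw [h2]
  exact sum_sum_pow_roots_eq S d hd (c : ℂ) l

/-! ### The unconditional finite-section trace formula for the function-field weights -/

/-- The model vector `e = (b_t)` for `p_S`. [cite: Connes1999, §VIII Lemma 1] -/
def baseVecS (S : Finset ι) (d : ι → ℕ) {c : ℝ} (hc : |c| < 1) : lp (fun _ : ℤ => ℂ) 2 :=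
  baseVec (bS S d c) (summable_norm_sq_bS S d hc)

/-- **Bernstein–Szegő for `|ζ_S|²`**: the shift model of `p_S` satisfies `IsBernsteinSzego`
unconditionally (`0 < d_v`, `|c| < 1`). [cite: Szego1939, §11.2 Thm 11.2, eq. (11.2.2)] -/
theorem isBernsteinSzego (S : Finset ι) (d : ι → ℕ) (hd : ∀ v ∈ S, 0 < d v) {c : ℝ} (hc : |c| < 1) :
    IsBernsteinSzego shift (baseVecS S d hc) (rootEnum S d c) :=
  ShiftModel.isBernsteinSzego (summable_norm_sq_bS S d hc)
    (fun _ hi => coeff_pS_eq_zero S d c hi) (conv_pS S d hd c) (hroots_pS S d hd c)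

/-- **Exact semilocal trace formula at finite level (function-field weights), kernel form.**
For every finite family of degrees `d_v ≥ 1`, every `c` with `|c| < 1` (census: `c = q^{-1/2}`),
every level `n` with `σ = ∑_v d_v ≤ n + 1` and every `l ≥ 1`:
`Tr(Q_n S^l Q_n) = c^l ∑_{v : d_v ∣ l} d_v` on `H_n = span{e, …, Sⁿe}` — Connes' values
`q^{-l/2} ∑_{v∈S, d_v∣l} d_v` of `Tr(Q_Λ V(g_l))`, here independent of the level.
[cite: Connes1999, §VIII Lemma 1 (eq. (12)) and Cor. 2] [cite: Szego1939, §11.2 Thm 11.2] -/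
theorem trace_compShift (S : Finset ι) (d : ι → ℕ) (hd : ∀ v ∈ S, 0 < d v) {c : ℝ} (hc : |c| < 1)
    {n : ℕ} (hσ : ∑ v ∈ S, d v ≤ n + 1) {l : ℕ} (hl : 1 ≤ l) :
    LinearMap.trace ℂ _ (compShift shift (baseVecS S d hc) n l) =
      (c : ℂ) ^ l * ∑ v ∈ S with d v ∣ l, (d v : ℂ) := by
  rw [(isBernsteinSzego S d hd hc).trace_compShift hσ hl, sum_rootEnum_pow S d hd c l]

/-- `Tr Q_n = n + 1` (Connes' `dim B_Λ = 2N + 1 + (2 - 2g)`). [cite: Connes1999, §VIII Lemma 1 (eq. (12))] -/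
theorem trace_compShift_zero (S : Finset ι) (d : ι → ℕ) (hd : ∀ v ∈ S, 0 < d v) {c : ℝ}
    (hc : |c| < 1) (n : ℕ) :
    LinearMap.trace ℂ _ (compShift shift (baseVecS S d hc) n 0) = (n + 1 : ℕ) :=
  (isBernsteinSzego S d hd hc).trace_compShift_zero n

/-- The power identity `(Q_n S Q_n)^l = Q_n S^l Q_n` for the function-field weights, `σ ≤ n + 1`.
[cite: Szego1939, Thm 11.4.2, eq. (11.4.7)] -/
theorem compShift_one_pow (S : Finset ι) (d : ι → ℕ) (hd : ∀ v ∈ S, 0 < d v) {c : ℝ} (hc : |c| < 1)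
    {n : ℕ} (hσ : ∑ v ∈ S, d v ≤ n + 1) (l : ℕ) :
    compShift shift (baseVecS S d hc) n 1 ^ l = compShift shift (baseVecS S d hc) n l :=
  (isBernsteinSzego S d hd hc).compShift_one_pow hσ l

end FunctionField

end BernsteinSzego

end Literature.Analysis.Toeplitz
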